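import Summits.CriticalPhenomena.PercolationContinuityZ3.Theorems.PercNearOneGluingNoHeavyLowerTailThresholdRABStrict
import Summits.CriticalPhenomena.PercolationContinuityZ3.Theorems.PercNearOneGluingNoHeavyLowerTailThresholdTwoFibreRel

/-!
# `NoHeavyLowerTail` (crux stmt-CriticalPhenomena-4575), lane prim-ineq-gen-4 (gen 18): ALL fibre inequalities of the natural spectator
# certificate for the threshold slot `Θ_k`, every `k`, in the trace vocabulary of gen 17 (`…ThresholdTwoCount`)

Support file (`--supports stmt-CriticalPhenomena-4575`; memo `run/shared/lean/prim/prim-ineq-gen-4/PROOFS-RAB-ALL-K-g18.md` §5 / §8b).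
No definitions, no `sorry`, standard axioms.

For global up-sets `V, W` of finsets and a fibre `Y` (a finset), the spectator certificate of gen 17 §0(E) involves five trace counts:
`a = #{u ⊆ Y : u ∈ W ∩ V, k ≤ #u}`, `s = #{u ⊆ Y : u ∈ W ∩ V, #u < k}`, `c = #{z ⊆ Y : z ∈ W, Y \ z ∈ V}` (cross pairs),
`x = #{cross z : k ≤ #z}`, `x' = #{cross z : k ≤ #(Y \ z)}`.  This file proves, for every `k`:
* `cross_filter_le_diag`, `cross_cofilter_le_diag` (`x ≤ a`, `x' ≤ a`: graded Kleitman inside `𝒫(Y)`, from gen-17's `card_cross_le_card_diag`);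
* `fibre_rab` (`x + x' + s ≤ c + a` when `2k ≤ #Y + 2`: the fibre lemma (RAB_k), transported from the down-set theorem `rab_counting`);
* `fibre_rab_strict` (`x + x' + s + 1 ≤ c + a` when `2k ≤ #Y + 1`, `∅ ∉ V`, and `W ∩ V` has a member `u ⊆ Y` with `#u < k`);
* `cross_filter_add_cofilter_le` (`x + x' ≤ c` when `#Y < 2k`: no cross pair is large on both sides).
The translation up-trace ↔ down-set is `z ↦ Y \ z` on the members of `V` (resp. `W`) inside `Y` (`mem_downTrace`).
-/

namespace Summit.CriticalPhenomena.PercolationContinuityZ3.Theorems.ThresholdRAB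

open Finset

variable {α : Type*} [DecidableEq α]

/-! ### The down-trace `{Y \ v : v ∈ V, v ⊆ Y}` of an up-set -/

/-- Membership in the down-trace. [this work] -/
theorem mem_downTrace (V : Finset (Finset α)) (Y z : Finset α) :
    z ∈ (Y.powerset.filter fun v => v ∈ V).image (fun v => Y \ v) ↔ z ⊆ Y ∧ Y \ z ∈ V := by
  rw [mem_image]
  constructor
  · rintro ⟨v, hv, rfl⟩
    rw [mem_filter, mem_powerset] at hv
    exact ⟨sdiff_subset, by rw [Finset.sdiff_sdiff_eq_self hv.1]; exact hv.2⟩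
  · rintro ⟨hzY, hz⟩
    refine ⟨Y \ z, ?_, Finset.sdiff_sdiff_eq_self hzY⟩
    rw [mem_filter, mem_powerset]
    exact ⟨sdiff_subset, hz⟩

/-- The down-trace of an up-set is a lower set. [this work] -/
theorem isLowerSet_downTrace (V : Finset (Finset α)) (hV : IsUpperSet (V : Set (Finset α))) (Y : Finset α) :
    IsLowerSet (((Y.powerset.filter fun v => v ∈ V).image (fun v => Y \ v) : Finset (Finset α)) : Set (Finset α)) := by
  intro z w hwz hz
  rw [mem_coe, mem_downTrace] at hz ⊢
  exact ⟨hwz.trans hz.1, hV (sdiff_subset_sdiff (le_refl Y) hwz) hz.2⟩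

/-- Members of the down-trace lie inside `Y`. [this work] -/
theorem downTrace_subset (V : Finset (Finset α)) (Y : Finset α) :
    ∀ t ∈ (Y.powerset.filter fun v => v ∈ V).image (fun v => Y \ v), t ⊆ Y :=
  fun t ht => ((mem_downTrace V Y t).1 ht).1

/-- Cross pairs of the down-traces are the cross pairs of the traces (same `z`), for any extra predicate. [this work] -/
theorem downTrace_cross_eq (V W : Finset (Finset α)) (Y : Finset α) (P : Finset α → Prop) [DecidablePred P] :
    (((Y.powerset.filter fun v => v ∈ V).image (fun v => Y \ v)).filter fun z =>
        Y \ z ∈ (Y.powerset.filter fun w => w ∈ W).image (fun w => Y \ w)).filter P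
      = Y.powerset.filter fun z => (z ∈ W ∧ Y \ z ∈ V) ∧ P z := by
  ext z
  simp only [mem_filter, mem_powerset, mem_downTrace]
  constructor
  · rintro ⟨⟨⟨hzY, hzV⟩, -, hzW⟩, hP⟩
    rw [Finset.sdiff_sdiff_eq_self hzY] at hzW
    exact ⟨hzY, ⟨hzW, hzV⟩, hP⟩
  · rintro ⟨hzY, ⟨hzW, hzV⟩, hP⟩
    refine ⟨⟨⟨hzY, hzV⟩, sdiff_subset, ?_⟩, hP⟩
    rw [Finset.sdiff_sdiff_eq_self hzY]; exact hzW

/-- Cross pairs of the down-traces without extra predicate. [this work] -/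
theorem downTrace_cross_eq' (V W : Finset (Finset α)) (Y : Finset α) :
    (((Y.powerset.filter fun v => v ∈ V).image (fun v => Y \ v)).filter fun z =>
        Y \ z ∈ (Y.powerset.filter fun w => w ∈ W).image (fun w => Y \ w))
      = Y.powerset.filter fun z => z ∈ W ∧ Y \ z ∈ V := by
  have h := downTrace_cross_eq V W Y (fun _ => True)
  rw [filter_true_of_mem (fun _ _ => trivial)] at h
  rw [h]
  ext z; simp only [mem_filter, and_true]

/-- Common members of the down-traces ↔ common members of the traces, via `u = Y \ v`; with a cardinality predicate. [this work] -/
theorem card_downTrace_inter_filter (V W : Finset (Finset α)) (Y : Finset α) (Q : ℕ → Prop) [DecidablePred Q] :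
    #((((Y.powerset.filter fun v => v ∈ V).image (fun v => Y \ v))
        ∩ ((Y.powerset.filter fun w => w ∈ W).image (fun w => Y \ w))).filter fun v => Q #v)
      = #(Y.powerset.filter fun u => (u ∈ W ∧ u ∈ V) ∧ Q (#Y - #u)) := by
  refine card_bij (fun v _ => Y \ v) (fun v hv => ?_) (fun v hv v' hv' h => ?_) (fun u hu => ?_)
  · rw [mem_filter, mem_inter, mem_downTrace, mem_downTrace] at hv
    rw [mem_filter, mem_powerset, card_sdiff_of_subset hv.1.1.1]
    have : #Y - (#Y - #v) = #v := by have := card_le_card hv.1.1.1; omega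
    rw [this]
    exact ⟨sdiff_subset, ⟨hv.1.2.2, hv.1.1.2⟩, hv.2⟩
  · rw [mem_filter, mem_inter, mem_downTrace] at hv hv'
    rw [← Finset.sdiff_sdiff_eq_self hv.1.1.1, h, Finset.sdiff_sdiff_eq_self hv'.1.1.1]
  · rw [mem_filter, mem_powerset] at hu
    refine ⟨Y \ u, ?_, Finset.sdiff_sdiff_eq_self hu.1⟩
    rw [mem_filter, mem_inter, mem_downTrace, mem_downTrace, Finset.sdiff_sdiff_eq_self hu.1, card_sdiff_of_subset hu.1]
    exact ⟨⟨⟨sdiff_subset, hu.2.1.2⟩, ⟨sdiff_subset, hu.2.1.1⟩⟩, hu.2.2⟩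

/-! ### The fibre inequalities -/

/-- Graded Kleitman inside `𝒫(Y)`: `#{z ⊆ Y : z ∈ W, Y\z ∈ V, k ≤ #z} ≤ #{u ⊆ Y : u ∈ W ∩ V, k ≤ #u}`. [this work] -/
theorem cross_filter_le_diag (V W : Finset (Finset α)) (hV : IsUpperSet (V : Set (Finset α)))
    (hW : IsUpperSet (W : Set (Finset α))) (Y : Finset α) (k : ℕ) :
    #(Y.powerset.filter fun z => (z ∈ W ∧ Y \ z ∈ V) ∧ k ≤ #z)
      ≤ #(Y.powerset.filter fun u => (u ∈ W ∧ u ∈ V) ∧ k ≤ #u) := by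
  have h := ThresholdTwoFibre.card_cross_le_card_diag Y (W.filter fun z => k ≤ #z) V
    (ThresholdTwoFibre.isUpperSet_filter_card_le W hW k) hV
  have e1 : (Y.powerset.filter fun z => z ∈ W.filter (fun z => k ≤ #z) ∧ Y \ z ∈ V)
      = Y.powerset.filter fun z => (z ∈ W ∧ Y \ z ∈ V) ∧ k ≤ #z := by
    ext z; simp only [mem_filter]; tauto
  have e2 : (Y.powerset.filter fun u => u ∈ W.filter (fun z => k ≤ #z) ∧ u ∈ V)
      = Y.powerset.filter fun u => (u ∈ W ∧ u ∈ V) ∧ k ≤ #u := by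
    ext u; simp only [mem_filter]; tauto
  rwa [e1, e2] at h

/-- Graded Kleitman, mirror form: `#{z ⊆ Y : z ∈ W, Y\z ∈ V, k ≤ #(Y\z)} ≤ #{u ⊆ Y : u ∈ W ∩ V, k ≤ #u}`. [this work] -/
theorem cross_cofilter_le_diag (V W : Finset (Finset α)) (hV : IsUpperSet (V : Set (Finset α)))
    (hW : IsUpperSet (W : Set (Finset α))) (Y : Finset α) (k : ℕ) :
    #(Y.powerset.filter fun z => (z ∈ W ∧ Y \ z ∈ V) ∧ k ≤ #(Y \ z))
      ≤ #(Y.powerset.filter fun u => (u ∈ W ∧ u ∈ V) ∧ k ≤ #u) := by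
  -- swap the roles of V and W via z ↦ Y \ z
  have h := cross_filter_le_diag W V hW hV Y k
  have e1 : #(Y.powerset.filter fun z => (z ∈ W ∧ Y \ z ∈ V) ∧ k ≤ #(Y \ z))
      = #(Y.powerset.filter fun z => (z ∈ V ∧ Y \ z ∈ W) ∧ k ≤ #z) := by
    refine card_bij (fun z _ => Y \ z) (fun z hz => ?_) (fun z hz z' hz' hzz => ?_) (fun z hz => ?_)
    · rw [mem_filter, mem_powerset] at hz ⊢
      rw [Finset.sdiff_sdiff_eq_self hz.1]
      exact ⟨sdiff_subset, ⟨hz.2.1.2, hz.2.1.1⟩, hz.2.2⟩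
    · rw [mem_filter, mem_powerset] at hz hz'
      rw [← Finset.sdiff_sdiff_eq_self hz.1, hzz, Finset.sdiff_sdiff_eq_self hz'.1]
    · rw [mem_filter, mem_powerset] at hz
      refine ⟨Y \ z, ?_, Finset.sdiff_sdiff_eq_self hz.1⟩
      rw [mem_filter, mem_powerset, Finset.sdiff_sdiff_eq_self hz.1]
      exact ⟨sdiff_subset, ⟨hz.2.1.2, hz.2.1.1⟩, hz.2.2⟩
  have e2 : (Y.powerset.filter fun u => (u ∈ V ∧ u ∈ W) ∧ k ≤ #u) = Y.powerset.filter fun u => (u ∈ W ∧ u ∈ V) ∧ k ≤ #u := by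
    ext u; simp only [mem_filter]; tauto
  rw [e1, ← e2]; exact h

/-- **Fibre lemma (RAB_k) in trace form.**  For up-sets `V, W`, a finset `Y` with `2k ≤ #Y + 2`, writing `cross = {z ⊆ Y : z ∈ W, Y\z ∈ V}`:
`#{cross, k ≤ #z} + #{cross, #z + k ≤ #Y} + #{u ⊆ Y : u ∈ W∩V, #u < k} ≤ #cross + #{u ⊆ Y : u ∈ W∩V, k ≤ #u}`. [this work] -/
theorem fibre_rab (V W : Finset (Finset α)) (hV : IsUpperSet (V : Set (Finset α))) (hW : IsUpperSet (W : Set (Finset α)))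
    (Y : Finset α) (k : ℕ) (hk : 2 * k ≤ #Y + 2) :
    #(Y.powerset.filter fun z => (z ∈ W ∧ Y \ z ∈ V) ∧ k ≤ #z)
        + #(Y.powerset.filter fun z => (z ∈ W ∧ Y \ z ∈ V) ∧ #z + k ≤ #Y)
        + #(Y.powerset.filter fun u => (u ∈ W ∧ u ∈ V) ∧ #u < k)
      ≤ #(Y.powerset.filter fun z => z ∈ W ∧ Y \ z ∈ V) + #(Y.powerset.filter fun u => (u ∈ W ∧ u ∈ V) ∧ k ≤ #u) := by
  have h := rab_counting Y k ((Y.powerset.filter fun v => v ∈ V).image (fun v => Y \ v))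
    ((Y.powerset.filter fun w => w ∈ W).image (fun w => Y \ w)) (isLowerSet_downTrace V hV Y) (isLowerSet_downTrace W hW Y)
    (downTrace_subset V Y) (downTrace_subset W Y) hk
  have hd1 := card_downTrace_inter_filter V W Y (fun c => #Y < c + k)
  have hd2 := card_downTrace_inter_filter V W Y (fun c => c + k ≤ #Y)
  rw [downTrace_cross_eq, downTrace_cross_eq, downTrace_cross_eq', hd1, hd2] at h
  have e1 : (Y.powerset.filter fun u => (u ∈ W ∧ u ∈ V) ∧ #Y < #Y - #u + k) = Y.powerset.filter fun u => (u ∈ W ∧ u ∈ V) ∧ #u < k := by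
    ext u; simp only [mem_filter, mem_powerset]
    constructor
    · rintro ⟨h1, h2, h3⟩; have := card_le_card h1; exact ⟨h1, h2, by omega⟩
    · rintro ⟨h1, h2, h3⟩; have := card_le_card h1; exact ⟨h1, h2, by omega⟩
  have e2 : (Y.powerset.filter fun u => (u ∈ W ∧ u ∈ V) ∧ #Y - #u + k ≤ #Y) = Y.powerset.filter fun u => (u ∈ W ∧ u ∈ V) ∧ k ≤ #u := by
    ext u; simp only [mem_filter, mem_powerset]
    constructor
    · rintro ⟨h1, h2, h3⟩; have := card_le_card h1; exact ⟨h1, h2, by omega⟩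
    · rintro ⟨h1, h2, h3⟩; have := card_le_card h1; exact ⟨h1, h2, by omega⟩
  rw [e1, e2] at h
  exact h

/-- **Strict fibre lemma in trace form.**  As `fibre_rab`, with `2k ≤ #Y + 1`, `∅ ∉ V`, and a common member `u₀ ⊆ Y` of `W ∩ V` with
`#u₀ < k` (necessarily nonempty): the inequality holds with `+ 1` on the left. [this work] -/
theorem fibre_rab_strict (V W : Finset (Finset α)) (hV : IsUpperSet (V : Set (Finset α))) (hW : IsUpperSet (W : Set (Finset α)))
    (hV0 : ∅ ∉ V) (Y : Finset α) (k : ℕ) (hk : 2 * k ≤ #Y + 1) {u₀ : Finset α} (hu₀Y : u₀ ⊆ Y) (hu₀W : u₀ ∈ W) (hu₀V : u₀ ∈ V)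
    (hu₀k : #u₀ < k) :
    #(Y.powerset.filter fun z => (z ∈ W ∧ Y \ z ∈ V) ∧ k ≤ #z)
        + #(Y.powerset.filter fun z => (z ∈ W ∧ Y \ z ∈ V) ∧ #z + k ≤ #Y)
        + #(Y.powerset.filter fun u => (u ∈ W ∧ u ∈ V) ∧ #u < k) + 1
      ≤ #(Y.powerset.filter fun z => z ∈ W ∧ Y \ z ∈ V) + #(Y.powerset.filter fun u => (u ∈ W ∧ u ∈ V) ∧ k ≤ #u) := by
  have hu₀c := card_le_card hu₀Y
  have h := rab_strict_counting Y k ((Y.powerset.filter fun v => v ∈ V).image (fun v => Y \ v))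
    ((Y.powerset.filter fun w => w ∈ W).image (fun w => Y \ w)) (isLowerSet_downTrace V hV Y) (isLowerSet_downTrace W hW Y)
    (downTrace_subset V Y) (downTrace_subset W Y) hk
    (by
      rw [mem_inter, mem_downTrace]
      intro h; rw [sdiff_self] at h; exact hV0 h.1.2)
    ⟨Y \ u₀, by
      rw [mem_inter, mem_downTrace, mem_downTrace, Finset.sdiff_sdiff_eq_self hu₀Y]
      exact ⟨⟨sdiff_subset, hu₀V⟩, ⟨sdiff_subset, hu₀W⟩⟩, by rw [card_sdiff_of_subset hu₀Y]; omega⟩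
  have hd1 := card_downTrace_inter_filter V W Y (fun c => #Y < c + k)
  have hd2 := card_downTrace_inter_filter V W Y (fun c => c + k ≤ #Y)
  rw [downTrace_cross_eq, downTrace_cross_eq, downTrace_cross_eq', hd1, hd2] at h
  have e1 : (Y.powerset.filter fun u => (u ∈ W ∧ u ∈ V) ∧ #Y < #Y - #u + k) = Y.powerset.filter fun u => (u ∈ W ∧ u ∈ V) ∧ #u < k := by
    ext u; simp only [mem_filter, mem_powerset]
    constructor
    · rintro ⟨h1, h2, h3⟩; have := card_le_card h1; exact ⟨h1, h2, by omega⟩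
    · rintro ⟨h1, h2, h3⟩; have := card_le_card h1; exact ⟨h1, h2, by omega⟩
  have e2 : (Y.powerset.filter fun u => (u ∈ W ∧ u ∈ V) ∧ #Y - #u + k ≤ #Y) = Y.powerset.filter fun u => (u ∈ W ∧ u ∈ V) ∧ k ≤ #u := by
    ext u; simp only [mem_filter, mem_powerset]
    constructor
    · rintro ⟨h1, h2, h3⟩; have := card_le_card h1; exact ⟨h1, h2, by omega⟩
    · rintro ⟨h1, h2, h3⟩; have := card_le_card h1; exact ⟨h1, h2, by omega⟩
  rw [e1, e2] at h
  exact h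

/-- On a small fibre (`#Y < 2k`) no cross pair is large on both sides: `#{cross, k ≤ #z} + #{cross, k ≤ #(Y\z)} ≤ #cross`. [this work] -/
theorem cross_filter_add_cofilter_le (V W : Finset (Finset α)) (Y : Finset α) (k : ℕ) (hY : #Y < 2 * k) :
    #(Y.powerset.filter fun z => (z ∈ W ∧ Y \ z ∈ V) ∧ k ≤ #z)
        + #(Y.powerset.filter fun z => (z ∈ W ∧ Y \ z ∈ V) ∧ k ≤ #(Y \ z))
      ≤ #(Y.powerset.filter fun z => z ∈ W ∧ Y \ z ∈ V) := by
  rw [← card_union_of_disjoint]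
  · apply card_le_card
    intro z hz
    rw [mem_union, mem_filter, mem_filter] at hz
    rw [mem_filter]
    rcases hz with h | h
    · exact ⟨h.1, h.2.1⟩
    · exact ⟨h.1, h.2.1⟩
  · rw [disjoint_left]
    intro z hz hz'
    rw [mem_filter, mem_powerset] at hz hz'
    have := card_sdiff_of_subset hz.1
    have := card_le_card hz.1
    omega

end Summit.CriticalPhenomena.PercolationContinuityZ3.Theorems.ThresholdRAB
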